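import Summits.KontsevichZagierPeriods.KontsevichZagierPeriods.Theorems.HurwitzMicroSectorsNormalFormPrincipleM2FiveZetaTwo
import Summits.KontsevichZagierPeriods.KontsevichZagierPeriods.Theorems.HurwitzMicroSectorsNormalFormPrincipleM2IntegrableLogsDisc

/-!
# `NormalFormPrinciple` (stmt-KontsevichZagierPeriods-3869), line `SketchIdeator1` — leaf `stub_boxRigidity`,
# dimension two off the product type (`CatalanTwoWays`, half-angle/Möbius/Catalan side): the log monomial `K` versus the wedge `K'`

Registered sub-goal `logMonomialInvId_sub_wedge` of the layer `CatalanTwoWays`. Let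
`σ = {0 < u < 1} ⊆ ℝ¹`. For any representation `K` on the band `{0 < u < 1, 1 ≤ t ≤ 1/u}` with
integrand `(1/(1+u²))/t` there (the unfolded log monomial `M(1/(1+u²), 1/u)`, of value Catalan's
`G = -∫₀¹ log u/(1+u²) du`) and any representation `K'` on the wedge `{0 < u < 1, u ≤ y ≤ 1}` with
integrand `1/((1+u²) y)` there, `[K] − [K']` is a relation. It is the sum of two instances of
Kontsevich–Zagier's rule (2): the fibre substitution `t = 1 + θ (1/u − 1)`
(`KZ.of_sub_of_mem_relations_fibreSubst`) carries `K` to the auxiliary band-box representation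
`Kb = [{0 < u < 1, 0 ≤ θ ≤ 1}, (1/(1+u²)) (1/u − 1)/(1 + θ (1/u − 1))]` (an integral representation
by `KZ.integrableOn_box₁` and the integrability of `log (1/u)/(1+u²)` on `(0,1)`,
`integrable_logs_disc`), and the affine substitution `y = u + θ (1 − u)` along the last coordinate
(`KZ.of_sub_of_mem_relations_of_affine`, `α = u`, `β = 1 − u > 0`) carries `Kb` to `K'`, since
`(1/(1+u²)) (1/u − 1)/(1 + θ (1/u − 1)) = (1 − u)/((1+u²)(u + θ (1 − u)))`.

References: M. Kontsevich, D. Zagier, *Periods* (2001), §1.2, rule (2). No new definitions.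
-/

noncomputable section

open MeasureTheory Set
open Literature.NumberTheory.Transcendental Literature.NumberTheory.Transcendental.KZ
open Literature.ModelTheory.ExponentialFields (IsSemialgebraic)

namespace Summit.KontsevichZagierPeriods.HurwitzMicroSectors.NormalFormPrinciple.PiBox.M2

/-- The pointwise identity behind the affine move `y = u + θ (1 − u)` from the band-box to the
wedge: `(1/(1+u²)) (1/u − 1)/(1 + θ (1/u − 1)) = 1/((1+u²)(u + (1 − u) θ)) · (1 − u)` for
`0 < u < 1`, `0 ≤ θ`. [folklore] -/
theorem wedge_affine_identity {u θ : ℝ} (hu0 : 0 < u) (hu1 : u < 1) (hθ : 0 ≤ θ) :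
    1 / (1 + u ^ 2) * (1 / u - 1) / (1 + θ * (1 / u - 1)) =
      1 / ((1 + u ^ 2) * (u + (1 - u) * θ)) * (1 - u) := by
  have h1 : (1 + u ^ 2 : ℝ) ≠ 0 := by positivity
  have h2 : 0 < u + (1 - u) * θ := by nlinarith [mul_nonneg (sub_pos.2 hu1).le hθ]
  have h3 : 1 + θ * (1 / u - 1) = (u + (1 - u) * θ) / u := by
    field_simp
  rw [h3]
  field_simp

/-- **The log monomial `K = M(1/(1+u²), 1/u)` versus the wedge `K'`** (registered sub-goal of the
layer `CatalanTwoWays` of `stub_boxRigidity` in dimension two; Kontsevich–Zagier rule 2 twice).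
For any representation `K` on the band `{0 < u < 1, 1 ≤ t ≤ 1/u}` with integrand `(1/(1+u²))/t`
there and any representation `K'` on the wedge `{0 < u < 1, u ≤ y ≤ 1}` with integrand
`1/((1+u²) y)` there, `[K] − [K'] ∈ relations`: the fibre substitution `t = 1 + θ (1/u − 1)`
(`KZ.of_sub_of_mem_relations_fibreSubst`) followed by the affine substitution `y = u + θ (1 − u)`
(`KZ.of_sub_of_mem_relations_of_affine`), through the band-box representation
`[{0 < u < 1, 0 ≤ θ ≤ 1}, (1/(1+u²)) (1/u − 1)/(1 + θ (1/u − 1))]` (`KZ.integrableOn_box₁`,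
`integrable_logs_disc`). [cite: KontsevichZagier2001, §1.2 rule (2)] -/
theorem logMonomialInvId_sub_wedge (K K' : IntegralRep 2)
    (hKd : K.domain = KZlog.band {y : Fin 1 → ℝ | 0 < y 0 ∧ y 0 < 1} (fun _ => (1:ℝ)) (fun y => 1 / y 0))
    (hKi : EqOn K.integrand (fun z => (1 / (1 + z 0 ^ 2)) / z 1) K.domain)
    (hK'd : K'.domain = KZlog.band {y : Fin 1 → ℝ | 0 < y 0 ∧ y 0 < 1} (fun y => y 0) (fun _ => (1:ℝ)))
    (hK'i : EqOn K'.integrand (fun z => 1 / ((1 + z 0 ^ 2) * z 1)) K'.domain) :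
    of K - of K' ∈ relations := by
  -- the open base `σ = (0,1) ⊆ ℝ¹`
  have hS : IsSemialgebraic ℚ {y : Fin 1 → ℝ | 0 < y 0 ∧ y 0 < 1} :=
    isSemialgebraic_unitInterval_fin_one
  have hGo : IsOpen {y : Fin 1 → ℝ | 0 < y 0 ∧ y 0 < 1} :=
    isOpen_Ioo.preimage (continuous_apply 0)
  -- the weight `f = 1/(1+u²)`, the edge `v = 1/u ≥ 1` and `c = v - 1 ≥ 0`
  have hf : IsSemialgebraicFunOn ℚ {y : Fin 1 → ℝ | 0 < y 0 ∧ y 0 < 1}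
      (fun y => 1 / (1 + y 0 ^ 2)) := by
    refine (isSemialgebraicFunOn_aeval_div_aeval hS 1 (1 + MvPolynomial.X 0 ^ 2)
      fun x _ => ?_).congr fun x _ => by simp
    simp only [map_add, map_one, map_pow, MvPolynomial.aeval_X]
    positivity
  have hv : IsSemialgebraicFunOn ℚ {y : Fin 1 → ℝ | 0 < y 0 ∧ y 0 < 1} (fun y => 1 / y 0) := by
    refine (isSemialgebraicFunOn_aeval_div_aeval hS 1 (MvPolynomial.X 0)
      fun y hy => ?_).congr fun y _ => by simp
    simpa using hy.1.ne'
  have hv1 : ∀ y ∈ {y : Fin 1 → ℝ | 0 < y 0 ∧ y 0 < 1}, 1 ≤ 1 / y 0 :=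
    fun y hy => one_le_one_div hy.1 hy.2.le
  have hc : IsSemialgebraicFunOn ℚ {y : Fin 1 → ℝ | 0 < y 0 ∧ y 0 < 1}
      (fun y => 1 / y 0 - 1) :=
    (IsSemialgebraicFunOn.sub_holds hv (isSemialgebraicFunOn_ratCast hS 1)).congr
      fun y _ => by simp
  have hc0 : ∀ y ∈ {y : Fin 1 → ℝ | 0 < y 0 ∧ y 0 < 1}, 0 ≤ 1 / y 0 - 1 :=
    fun y hy => sub_nonneg.2 (hv1 y hy)
  -- integrability of `f log (1 + c) = log (1/u)/(1+u²)` on the base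
  have hint : IntegrableOn (fun y : Fin 1 → ℝ => 1 / (1 + y 0 ^ 2) * Real.log (1 + (1 / y 0 - 1)))
      {y : Fin 1 → ℝ | 0 < y 0 ∧ y 0 < 1} := by
    have e : (fun y : Fin 1 → ℝ => 1 / (1 + y 0 ^ 2) * Real.log (1 + (1 / y 0 - 1))) =
        fun y : Fin 1 → ℝ => (fun u : ℝ => 1 / (1 + u ^ 2) * Real.log (1 / u)) (y 0) := by
      funext y
      rw [add_sub_cancel]
    rw [e]
    exact integrableOn_fin_one_of_integrableOn_Ioo (integrable_logs_disc.2.2.2 0 1 le_rfl le_rfl)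
  -- the auxiliary band-box representation `Kb`
  obtain ⟨Kb, hKbd, hKbi⟩ : ∃ Kb : IntegralRep 2,
      Kb.domain = KZlog.band {y : Fin 1 → ℝ | 0 < y 0 ∧ y 0 < 1} (fun _ => (0:ℝ)) (fun _ => (1:ℝ)) ∧
      Kb.integrand = fun w => 1 / (1 + Fin.init w 0 ^ 2) * (1 / Fin.init w 0 - 1) /
        (1 + w (Fin.last 1) * (1 / Fin.init w 0 - 1)) :=
    ⟨⟨_, _, isSemialgebraic_bandBox,
      isSemialgebraicFunOn_box₁ (f := fun y => 1 / (1 + y 0 ^ 2)) (c := fun y => 1 / y 0 - 1)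
        hS hf hc hc0,
      integrableOn_box₁ (f := fun y => 1 / (1 + y 0 ^ 2)) (c := fun y => 1 / y 0 - 1)
        hS hf hc hc0 hint⟩, rfl, rfl⟩
  -- (a) the fibre substitution `t = 1 + θ (1/u - 1)`: `[K] - [Kb] ∈ relations`
  have hKKb : of K - of Kb ∈ relations :=
    of_sub_of_mem_relations_fibreSubst (m := 1) (f := fun y => 1 / (1 + y 0 ^ 2))
      (v := fun y => 1 / y 0) hS hv hv1 K Kb hKd hKi hKbd (fun z _ => by rw [hKbi])
  -- (b) the affine substitution `y = u + θ (1 - u)`: `[Kb] - [K'] ∈ relations`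
  have hα : IsSemialgebraicFunOn ℚ {y : Fin 1 → ℝ | 0 < y 0 ∧ y 0 < 1} (fun y => y 0) :=
    isSemialgebraicFunOn_apply hS 0
  have hβ : IsSemialgebraicFunOn ℚ {y : Fin 1 → ℝ | 0 < y 0 ∧ y 0 < 1} (fun y => 1 - y 0) :=
    (isSemialgebraicFunOn_aeval hS (1 - MvPolynomial.X 0)).congr fun x _ => by simp
  have hαd : DifferentiableOn ℝ (fun y : Fin 1 → ℝ => y 0) {y : Fin 1 → ℝ | 0 < y 0 ∧ y 0 < 1} :=
    fun y _ => by fun_prop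
  have hβd : DifferentiableOn ℝ (fun y : Fin 1 → ℝ => 1 - y 0)
      {y : Fin 1 → ℝ | 0 < y 0 ∧ y 0 < 1} :=
    fun y _ => by fun_prop
  have hβpos : ∀ y ∈ {y : Fin 1 → ℝ | 0 < y 0 ∧ y 0 < 1}, 0 < 1 - y 0 :=
    fun y hy => sub_pos.2 hy.2
  have key : ∀ z ∈ Kb.domain, Kb.integrand z =
      K'.integrand (Fin.snoc (Fin.init z)
        (Fin.init z 0 + (1 - Fin.init z 0) * z (Fin.last 1))) * (1 - Fin.init z 0) := by
    intro z hz
    rw [hKbd] at hz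
    obtain ⟨hzG, h0, h1⟩ := KZlog.mem_band.1 hz
    have hx : 0 < Fin.init z 0 ∧ Fin.init z 0 < 1 := hzG
    have h0' : (0:ℝ) ≤ z (Fin.last 1) := h0
    have h1' : z (Fin.last 1) ≤ 1 := h1
    have hw : (Fin.snoc (Fin.init z) (Fin.init z 0 + (1 - Fin.init z 0) * z (Fin.last 1)) :
        Fin 2 → ℝ) ∈ K'.domain := by
      rw [hK'd]
      refine KZlog.mem_band.2 ?_
      rw [Fin.init_snoc, Fin.snoc_last]
      refine ⟨hzG, ?_, ?_⟩
      · show Fin.init z 0 ≤ Fin.init z 0 + (1 - Fin.init z 0) * z (Fin.last 1)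
        nlinarith [mul_nonneg (sub_pos.2 hx.2).le h0']
      · show Fin.init z 0 + (1 - Fin.init z 0) * z (Fin.last 1) ≤ 1
        nlinarith [mul_le_mul_of_nonneg_left h1' (sub_pos.2 hx.2).le]
    rw [hKbi, hK'i hw]
    show 1 / (1 + z 0 ^ 2) * (1 / z 0 - 1) / (1 + z 1 * (1 / z 0 - 1)) =
      1 / ((1 + z 0 ^ 2) * (z 0 + (1 - z 0) * z 1)) * (1 - z 0)
    exact wedge_affine_identity hx.1 hx.2 h0'
  have hKbK' : of Kb - of K' ∈ relations :=
    of_sub_of_mem_relations_of_affine (m := 1) hGo (α := fun y => y 0) (β := fun y => 1 - y 0)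
      (a := fun _ => (0:ℝ)) (b := fun _ => (1:ℝ)) (a' := fun y => y 0) (b' := fun _ => (1:ℝ))
      hα hβ hαd hβd hβpos Kb K' hKbd hK'd (fun y _ => by ring) (fun y _ => by ring) key
  -- (c) `[K] - [K'] = ([K] - [Kb]) + ([Kb] - [K'])`
  have h := relations.add_mem hKKb hKbK'
  rwa [sub_add_sub_cancel] at h

end Summit.KontsevichZagierPeriods.HurwitzMicroSectors.NormalFormPrinciple.PiBox.M2
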